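import Summits.KontsevichZagierPeriods.KontsevichZagierPeriods.Theses.SymplecticScissors
import Literature.NumberTheory.Transcendental.AyoubPeriodSeries
import Literature.NumberTheory.Transcendental.AyoubPeriodSeriesKernel
import Literature.NumberTheory.Transcendental.AyoubPeriodSeriesPiAlgebraic
import Literature.NumberTheory.Transcendental.AyoubPeriodSeriesLocalizing
import Literature.NumberTheory.Transcendental.AyoubPeriodSeriesVariables
import Summits.KontsevichZagierPeriods.KontsevichZagierPeriods.Theorems.UnfoldedStokesStokesGenerationStubSpanToRepsAuxCoeff
import Summits.KontsevichZagierPeriods.KontsevichZagierPeriods.Theorems.SymplecticScissorsTypeAGenerationStubRoomStepCongruence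
import Mathlib.RingTheory.MvPowerSeries.Rename
import Mathlib.RingTheory.MvPowerSeries.Substitution

/-!
# `TypeAGeneration` (stmt-KontsevichZagierPeriods-18392), line `Sketch`, stub `stub_transposition` (S1)

For `F ∈ 𝒪_{k-alg}(𝔻̄^∞)` (`AyoubRel.Oan σ`) free of `z_j`, `i ≠ j`: `F − F^{(i j)}` lies in the
`k`-span of the type-(a) elements `AyoubRel.relAC n G`, `G ∈ 𝒪_{k-alg}(𝔻̄^∞)` (J. Ayoub, Ann. of
Math. 181 (2015), Rem. 1.5 style certificate `relAC i (zᵢ T) − relAC j (z_j T)`, `T = F(zᵢ z_j, w)`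
via `MvPowerSeries.subst` along the family `l ↦ [l = i] zᵢ z_j + [l ≠ i] z_l`; `T ∈ 𝒪_{k-alg}(𝔻̄^∞)`:
polyradius `√r`, algebraicity transported along the injective substitution, which commutes with
`k[z] → ℂ[[z]]`). Helper names carry the prefix `s1`; the face lemmas `s2_*` of the sibling stub file
`…StubRoomStepCongruence.lean` are reused. No definition is introduced.
-/

noncomputable section

-- `Summit.KontsevichZagierPeriods.KontsevichZagierPeriods.…` is the tree's mandated layout (single-conjunct summit).
set_option linter.dupNamespace false

namespace Summit.KontsevichZagierPeriods.KontsevichZagierPeriods.TypeAGenerationLine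

open Finsupp MvPowerSeries
open Literature.NumberTheory.Transcendental
open Literature.NumberTheory.Transcendental.AyoubRel
open Summit.KontsevichZagierPeriods.KontsevichZagierPeriods.Theses.SymplecticScissors (TypeAGeneration)

/-! ## The substitution `zᵢ ↦ zᵢ z_j` -/

section Subst

variable {i j : ℕ}

/-- The family `zᵢ ↦ zᵢ z_j`, `z_l ↦ z_l` (`l ≠ i`) can be substituted (no constant terms, each
monomial occurs in finitely many members). [folklore] -/
theorem s1_hasSubst (i j : ℕ) :
    HasSubst (fun l : ℕ => if l = i then (X i * X j : CSeries) else X l) := by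
  classical
  refine ⟨fun s => ⟨1, ?_⟩, fun d => ?_⟩
  · show constantCoeff (if s = i then (X i * X j : CSeries) else X s) ^ 1 = 0
    split_ifs <;> simp [constantCoeff_X]
  · refine Set.Finite.subset ((d.support : Set ℕ).toFinite.union (Set.finite_singleton i))
      fun s hs => ?_
    by_cases hsi : s = i
    · exact Or.inr hsi
    · left
      have h1 : coeff d (X s : CSeries) ≠ 0 := by
        simpa only [Set.mem_setOf_eq, if_neg hsi] using hs
      rw [coeff_X] at h1
      have hd : d = single s 1 := of_not_not fun h => h1 (if_neg h)
      rw [Finset.mem_coe, hd, Finsupp.mem_support_iff, single_eq_same]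
      exact one_ne_zero

/-- The substitution sends the monomial `z^d` to `z^{d + dᵢ e_j}`. [folklore] -/
theorem s1_prod_pow (i j : ℕ) (d : ℕ →₀ ℕ) :
    (d.prod fun s n => (if s = i then (X i * X j : CSeries) else X s) ^ n) =
      monomial (d + single j (d i)) (1 : ℂ) := by
  classical
  have h1 : (d.prod fun s n => (if s = i then (X i * X j : CSeries) else X s) ^ n) =
      (d.prod fun s n => (X s : CSeries) ^ n) *
        d.prod fun s n => (if i = s then (X j : CSeries) ^ n else 1) := by
    rw [← Finsupp.prod_mul]
    refine Finsupp.prod_congr fun s _ => ?_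
    by_cases h : s = i
    · subst h
      rw [if_pos rfl, if_pos rfl, mul_pow]
    · rw [if_neg h, if_neg (Ne.symm h), mul_one]
  rw [h1, ← MvPowerSeries.monomial_one_eq, Finsupp.prod_ite_eq]
  have h2 : (if i ∈ d.support then (X j : CSeries) ^ d i else 1) = X j ^ d i := by
    split_ifs with h
    · rfl
    · rw [Finsupp.notMem_support_iff.mp h, pow_zero]
  rw [h2, X_pow_eq, monomial_mul_monomial, one_mul]

/-- The exponent map `d ↦ d + dᵢ e_j` is injective (`i ≠ j`). [folklore] -/
theorem s1_theta_injective (hij : i ≠ j) :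
    Function.Injective fun d : ℕ →₀ ℕ => d + single j (d i) := by
  intro d d' h
  have hi := DFunLike.congr_fun h i
  simp only [Finsupp.add_apply, single_apply, if_neg (Ne.symm hij), add_zero] at hi
  simp only [hi] at h
  exact add_right_cancel h

/-- Coefficients of the substituted series on the image of the exponent map:
`T_{d + dᵢ e_j} = G_d`. [folklore] -/
theorem s1_coeff_subst_theta (hij : i ≠ j) (G : CSeries) (d : ℕ →₀ ℕ) :
    coeff (d + single j (d i))
        (subst (fun l : ℕ => if l = i then (X i * X j : CSeries) else X l) G) = coeff d G := by
  classical
  rw [coeff_subst (s1_hasSubst i j), finsum_eq_single _ d]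
  · rw [s1_prod_pow, coeff_monomial_same, smul_eq_mul, mul_one]
  · intro d' hd'
    rw [s1_prod_pow, coeff_monomial, if_neg, smul_zero]
    intro h
    exact hd' (s1_theta_injective hij h).symm

/-- Coefficients of the substituted series vanish off the image of the exponent map. [folklore] -/
theorem s1_coeff_subst_eq_zero (G : CSeries) (e : ℕ →₀ ℕ)
    (he : ∀ d : ℕ →₀ ℕ, e ≠ d + single j (d i)) :
    coeff e (subst (fun l : ℕ => if l = i then (X i * X j : CSeries) else X l) G) = 0 := by
  classical
  rw [coeff_subst (s1_hasSubst i j)]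
  refine finsum_eq_zero_of_forall_eq_zero fun d => ?_
  rw [s1_prod_pow, coeff_monomial, if_neg (he d), smul_zero]

/-- The substitution `zᵢ ↦ zᵢ z_j` is injective on `ℂ[[z]]`. [folklore] -/
theorem s1_subst_injective (hij : i ≠ j) {G G' : CSeries}
    (h : subst (fun l : ℕ => if l = i then (X i * X j : CSeries) else X l) G =
      subst (fun l : ℕ => if l = i then (X i * X j : CSeries) else X l) G') : G = G' := by
  ext d
  rw [← s1_coeff_subst_theta hij G d, h, s1_coeff_subst_theta hij G' d]

/-- Coefficients of `T = F(zᵢ z_j, w)` for `F` free of `z_j`: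
`T_e = [e_j = e_i] F_{e ∖ j}`. [folklore] -/
theorem s1_coeff_T (hij : i ≠ j) {F : CSeries} (hF : ¬ UsesVar F j) (e : ℕ →₀ ℕ) :
    coeff e (subst (fun l : ℕ => if l = i then (X i * X j : CSeries) else X l) F) =
      if e j = e i then coeff (e.erase j) F else 0 := by
  split_ifs with h
  · have key : e.erase j + single j ((e.erase j) i) = e := by
      rw [erase_ne hij, ← h, erase_add_single]
    have h1 := s1_coeff_subst_theta hij F (e.erase j)
    rwa [key] at h1
  · by_cases hex : ∃ d : ℕ →₀ ℕ, e = d + single j (d i)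
    · obtain ⟨d, rfl⟩ := hex
      rw [s1_coeff_subst_theta hij]
      by_contra hne
      refine hF ⟨d, fun hdj => h ?_, hne⟩
      simp only [Finsupp.add_apply, single_apply, if_neg (Ne.symm hij), hdj, if_true, zero_add,
        add_zero]
    · push Not at hex
      exact s1_coeff_subst_eq_zero F e hex

end Subst

/-! ## `T = F(zᵢ z_j, w)` lies in `𝒪_{k-alg}(𝔻̄^∞)` -/

section Oan

variable {k : Type} [Field k] (σ : k →+* ℂ) {i j : ℕ}

/-- The substitution introduces at most the variable `z_j`. [folklore] -/
theorem s1_dependsOnlyOnLT_subst (hij : i ≠ j) {F : CSeries} {m : ℕ} (hF : DependsOnlyOnLT F m) :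
    DependsOnlyOnLT (subst (fun l : ℕ => if l = i then (X i * X j : CSeries) else X l) F)
      (max m (j + 1)) := by
  rintro e ⟨l, hl, hel⟩
  by_cases hex : ∃ d : ℕ →₀ ℕ, e = d + single j (d i)
  · obtain ⟨d, rfl⟩ := hex
    rw [s1_coeff_subst_theta hij]
    have hlj : j ≠ l := by
      have h1 := (le_max_right m (j + 1)).trans hl
      omega
    refine hF d ⟨l, (le_max_left _ _).trans hl, fun hdl => hel ?_⟩
    rw [Finsupp.add_apply, hdl, single_apply, if_neg hlj, add_zero]
  · push Not at hex
    exact s1_coeff_subst_eq_zero F e hex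

/-- The substituted series has polyradius `√r > 1` if `F` has polyradius `r > 1`
(`|d + dᵢ e_j| ≤ 2|d|`). [folklore] -/
theorem s1_hasPolyradiusGtOne_subst (hij : i ≠ j) {F : CSeries} (hF : HasPolyradiusGtOne F) :
    HasPolyradiusGtOne (subst (fun l : ℕ => if l = i then (X i * X j : CSeries) else X l) F) := by
  obtain ⟨r, hr, hs⟩ := hF
  have hρ1 : 1 < Real.sqrt r := (Real.lt_sqrt zero_le_one).mpr (by rw [one_pow]; exact hr)
  have hρsq : Real.sqrt r ^ 2 = r := Real.sq_sqrt (zero_le_one.trans hr.le)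
  refine ⟨Real.sqrt r, hρ1, ?_⟩
  refine ((s1_theta_injective hij).summable_iff ?_).mp ?_
  · intro e he
    rw [s1_coeff_subst_eq_zero F e fun d hd => he ⟨d, hd.symm⟩, norm_zero, zero_mul]
  · refine Summable.of_nonneg_of_le (fun d => ?_) (fun d => ?_) hs
    · simp only [Function.comp_apply]
      positivity
    · simp only [Function.comp_apply]
      rw [s1_coeff_subst_theta hij, map_add, degree_single]
      refine mul_le_mul_of_nonneg_left ?_ (norm_nonneg _)
      calc Real.sqrt r ^ (degree d + d i) ≤ Real.sqrt r ^ (degree d + degree d) :=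
            pow_le_pow_right₀ hρ1.le (by have := le_degree i d; omega)
        _ = r ^ degree d := by rw [← two_mul, pow_mul, hρsq]

/-- The substituted series is algebraic over `k(z)` if `F` is: the substitution `φ` of `ℂ[[z]]`
restricts along `k[z] → ℂ[[z]]` to the algebra endomorphism `f : zᵢ ↦ zᵢ z_j` of `k[z]`, which is
injective (because `φ` is), so an algebraic relation `P(F) = 0` is transported to
`P^f(φ F) = 0` with `P^f ≠ 0`. [folklore] -/
theorem s1_isAlgebraicOverRatFunc_subst (hij : i ≠ j) {F : CSeries}
    (hF : IsAlgebraicOverRatFunc σ F) :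
    IsAlgebraicOverRatFunc σ
      (subst (fun l : ℕ => if l = i then (X i * X j : CSeries) else X l) F) := by
  obtain ⟨P, hP0, hP⟩ := hF
  set φ : CSeries →+* CSeries := (substAlgHom (R := ℂ) (s1_hasSubst i j)).toRingHom with hφ
  set f : MvPolynomial ℕ k →+* MvPolynomial ℕ k := ↑(MvPolynomial.aeval (R := k) fun l : ℕ =>
    if l = i then MvPolynomial.X i * MvPolynomial.X j else (MvPolynomial.X l : MvPolynomial ℕ k))
    with hf
  have hφ' : ∀ G : CSeries,
      φ G = subst (fun l : ℕ => if l = i then (X i * X j : CSeries) else X l) G := fun G => by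
    rw [hφ, AlgHom.toRingHom_eq_coe, AlgHom.coe_toRingHom, substAlgHom_apply]
  have hX : ∀ n : ℕ, polyToCSeries σ (MvPolynomial.X n) = X n := fun n => by
    simp [polyToCSeries, MvPolynomial.coe_X]
  have hcomm : φ.comp (polyToCSeries σ) = (polyToCSeries σ).comp f := by
    refine MvPolynomial.ringHom_ext (fun a => ?_) (fun n => ?_)
    · rw [RingHom.comp_apply, RingHom.comp_apply, hφ', hf, RingHom.coe_coe, MvPolynomial.algHom_C]
      simp [polyToCSeries, MvPolynomial.coe_C, subst_C]
    · rw [RingHom.comp_apply, RingHom.comp_apply, hφ', hf, RingHom.coe_coe, MvPolynomial.aeval_X,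
        hX, subst_X (s1_hasSubst i j)]
      split_ifs
      · rw [map_mul, hX, hX]
      · exact (hX n).symm
  have hinj : Function.Injective f := by
    intro p q hpq
    have hp := DFunLike.congr_fun hcomm p
    have hq := DFunLike.congr_fun hcomm q
    simp only [RingHom.comp_apply, hpq, hφ'] at hp hq
    exact polyToCSeries_injective σ (s1_subst_injective hij (hp.trans hq.symm))
  refine ⟨P.map f, (Polynomial.map_ne_zero_iff hinj).mpr hP0, ?_⟩
  rw [Polynomial.eval₂_map, ← hcomm, ← hφ', ← Polynomial.hom_eval₂, hP, map_zero]

/-- **`T = F(zᵢ z_j, w) ∈ 𝒪_{k-alg}(𝔻̄^∞)`** for `F ∈ 𝒪_{k-alg}(𝔻̄^∞)`. [folklore] -/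
theorem s1_subst_mem_Oan (hij : i ≠ j) {F : CSeries} (hF : F ∈ Oan σ) :
    subst (fun l : ℕ => if l = i then (X i * X j : CSeries) else X l) F ∈ Oan σ := by
  obtain ⟨⟨m, hm⟩, hr, halg⟩ := hF
  exact ⟨⟨max m (j + 1), s1_dependsOnlyOnLT_subst hij hm⟩, s1_hasPolyradiusGtOne_subst hij hr,
    s1_isAlgebraicOverRatFunc_subst σ hij halg⟩

end Oan

/-! ## The certificate `relAC i (zᵢ T) − relAC j (z_j T) = F − F^{(i j)}` -/

section Certificate

variable {i j : ℕ} {F : CSeries}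

/-- Coefficients of `F^{(i j)}`: `coeff_b (F^{(i j)}) = F_{b ∘ (i j)}`. [folklore] -/
theorem s1_coeff_rename_swap (i j : ℕ) (F : CSeries) (b : ℕ →₀ ℕ) :
    coeff b (MvPowerSeries.rename (⇑(Equiv.swap i j)) F) =
      coeff (mapDomain (⇑(Equiv.swap i j)) b) F := by
  have hx : embDomain (Equiv.swap i j).toEmbedding (mapDomain (⇑(Equiv.swap i j)) b) = b := by
    ext l
    rw [embDomain_eq_mapDomain, Equiv.coe_toEmbedding, mapDomain_equiv_apply, Equiv.symm_swap,
      mapDomain_equiv_apply, Equiv.symm_swap, Equiv.swap_apply_self]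
  have h := coeff_embDomain_rename (Equiv.swap i j).toEmbedding F (mapDomain (⇑(Equiv.swap i j)) b)
  rw [hx] at h
  exact h

/-- `∂ᵢ (zᵢ T) = ∂_j (z_j T)`: both have coefficient `(n + 1) F_{β + n eᵢ}` at `β + n eᵢ + n e_j`.
[cite: Ayoub2015, Rem. 1.5] -/
theorem s1_pdz_eq (hij : i ≠ j) (hF : ¬ UsesVar F j) :
    pdz i (X i * subst (fun l : ℕ => if l = i then (X i * X j : CSeries) else X l) F) =
      pdz j (X j * subst (fun l : ℕ => if l = i then (X i * X j : CSeries) else X l) F) := by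
  ext b
  rw [StokesGenerationLine.coeff_pdz, StokesGenerationLine.coeff_pdz, s2_coeff_X_mul_add_single,
    s2_coeff_X_mul_add_single]
  by_cases h : b j = b i
  · rw [h]
  · rw [s1_coeff_T hij hF, if_neg h, mul_zero, mul_zero]

/-- `(z_j T)|_{z_j = 1} = F` (the single term `m = bᵢ` of the face sum of `T`).
[cite: Ayoub2015, Rem. 1.5] -/
theorem s1_restrC_one_H (hij : i ≠ j) (hF : ¬ UsesVar F j) :
    restrC j 1 (X j * subst (fun l : ℕ => if l = i then (X i * X j : CSeries) else X l) F) = F := by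
  rw [s2_restrC_one_X_mul]
  ext b
  rw [StokesGenerationLine.coeff_restrC]
  split_ifs with hb
  · have hbj : ∀ m : ℕ, (b + single j m) j = m ∧ (b + single j m) i = b i := fun m => by
      rw [Finsupp.add_apply, Finsupp.add_apply, hb, single_eq_same, single_apply,
        if_neg (Ne.symm hij), zero_add, add_zero]
      exact ⟨rfl, rfl⟩
    rw [tsum_eq_single (b i)]
    · rw [one_pow, mul_one, s1_coeff_T hij hF, if_pos ((hbj _).1.trans (hbj _).2.symm),
        erase_add_single_self, erase_of_notMem_support]
      simpa only [Finsupp.mem_support_iff, ne_eq, not_not] using hb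
    · intro m hm
      rw [one_pow, mul_one, s1_coeff_T hij hF, if_neg]
      rw [(hbj m).1, (hbj m).2]
      exact hm
  · exact (of_not_not fun hne => hF ⟨b, hb, hne⟩).symm

/-- `(zᵢ T)|_{zᵢ = 1} = F^{(i j)}` (the single term `m = b_j` of the face sum of `T`).
[cite: Ayoub2015, Rem. 1.5] -/
theorem s1_restrC_one_G (hij : i ≠ j) (hF : ¬ UsesVar F j) :
    restrC i 1 (X i * subst (fun l : ℕ => if l = i then (X i * X j : CSeries) else X l) F) =
      MvPowerSeries.rename (⇑(Equiv.swap i j)) F := by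
  rw [s2_restrC_one_X_mul]
  ext b
  rw [StokesGenerationLine.coeff_restrC, s1_coeff_rename_swap]
  split_ifs with hb
  · have hbi : ∀ m : ℕ, (b + single i m) j = b j ∧ (b + single i m) i = m := fun m => by
      rw [Finsupp.add_apply, Finsupp.add_apply, hb, single_eq_same, single_apply, if_neg hij,
        zero_add, add_zero]
      exact ⟨rfl, rfl⟩
    rw [tsum_eq_single (b j)]
    · rw [one_pow, mul_one, s1_coeff_T hij hF, if_pos ((hbi _).1.trans (hbi _).2.symm)]
      have heq : (b + single i (b j)).erase j = mapDomain (⇑(Equiv.swap i j)) b := by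
        ext l
        rw [mapDomain_equiv_apply, Equiv.symm_swap]
        by_cases hlj : l = j
        · subst hlj
          rw [erase_same, Equiv.swap_apply_right, hb]
        · rw [erase_ne hlj, Finsupp.add_apply, single_apply]
          by_cases hli : l = i
          · subst hli
            rw [if_pos rfl, Equiv.swap_apply_left, hb, zero_add]
          · rw [if_neg (Ne.symm hli), Equiv.swap_apply_of_ne_of_ne hli hlj, add_zero]
      rw [heq]
    · intro m hm
      rw [one_pow, mul_one, s1_coeff_T hij hF, if_neg]
      rw [(hbi m).1, (hbi m).2]
      exact Ne.symm hm
  · refine (of_not_not fun hne => hF ⟨_, ?_, hne⟩).symm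
    rwa [mapDomain_equiv_apply, Equiv.symm_swap, Equiv.swap_apply_right]

/-- **The transposition certificate**: `relAC i (zᵢ T) − relAC j (z_j T) = F − F^{(i j)}` for
`T = F(zᵢ z_j, w)`, `F` free of `z_j`, `i ≠ j`. [cite: Ayoub2015, Rem. 1.5] -/
theorem s1_certificate (hij : i ≠ j) (hF : ¬ UsesVar F j) :
    relAC i (X i * subst (fun l : ℕ => if l = i then (X i * X j : CSeries) else X l) F) -
        relAC j (X j * subst (fun l : ℕ => if l = i then (X i * X j : CSeries) else X l) F) =
      F - MvPowerSeries.rename (⇑(Equiv.swap i j)) F := by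
  rw [relAC, relAC, s1_pdz_eq hij hF, s2_restrC_zero_X_mul, s2_restrC_zero_X_mul,
    s1_restrC_one_H hij hF, s1_restrC_one_G hij hF]
  abel

end Certificate

/-! ## Registered form -/

/-- **S1 — transposition into a fresh variable is type (a).** For `F ∈ 𝒪_{k-alg}(𝔻̄^∞)` not
involving `z_j` (`i ≠ j`), `F − F^{(i j)}` lies in the `k`-span of type (a): with
`T = F(zᵢ z_j, w)` (the substitution `zᵢ ↦ zᵢ z_j`), `relAC i (zᵢ T) − relAC j (z_j T) = F − F^{(i j)}`
(`(zᵢT)|_{zᵢ=1} = F^{(i j)}`, `(z_jT)|_{z_j=1} = F`, both `|₀` vanish, the two derivatives agree),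
and `zᵢ T, z_j T ∈ 𝒪_{k-alg}(𝔻̄^∞)` (polyradius `√r`, algebraic by transport of structure along the
injective substitution). [cite: Ayoub2015, Rem. 1.5] -/
theorem stub_transposition :
    ∀ (k : Type) [Field k] [CharZero k] (σ : k →+* ℂ) (F : CSeries), F ∈ Oan σ →
      ∀ (i j : ℕ), i ≠ j → ¬ UsesVar F j →
        F - MvPowerSeries.rename (⇑(Equiv.swap i j)) F ∈
          kSpan σ {x : CSeries | ∃ G ∈ Oan σ, ∃ n : ℕ, x = relAC n G} := by
  intro k _ _ σ F hF i j hij hj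
  have hT := s1_subst_mem_Oan σ hij hF
  rw [← s1_certificate hij hj]
  exact kSpan_sub σ (subset_kSpan σ _ ⟨_, mul_mem_Oan σ (s2_X_mem_Oan σ i) hT, i, rfl⟩)
    (subset_kSpan σ _ ⟨_, mul_mem_Oan σ (s2_X_mem_Oan σ j) hT, j, rfl⟩)

end Summit.KontsevichZagierPeriods.KontsevichZagierPeriods.TypeAGenerationLine
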